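import Summits.MatrixMultiplication.MatrixMultiplication.Theorems.SaturationLadderGaugeCone
import Literature.Computability.AlgebraicComplexity.LaserSymmetrization
import Literature.Computability.AlgebraicComplexity.FlatteningRankCube
import HarnessLib

/-!
# Route `SaturationLadder` — the VIRTUAL FORMAT of an arbitrary base: single-base exact certificates from ANY
tensor obey the format laws of its flattening triple, and the gauge cone prices them all
(decomp-mm lens 1 «grading / quantitative ladder», gen 30; route-free helper: imports NO `Theses` file)

Gens 25–29 (and gen 30 part I, catalysts) price certificates whose base is a matrix multiplication FORMAT
`⟨p^{a'},p^{b'},p^{c'}⟩` (powers, catalysts).  This file removes the restriction: let `B` be ANY 3-tensor over `K` and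

  `B ⊵ ⟨t⟩ ⊗ ⟨q^a,q^b,q^c⟩`,   `U_B := (log R̃(B) − log t)/log q`   (so `ω(a,b,c) ≤ U_B`, Schönhage + monotonicity of `R̃`).

With `Xᵢ := log ζ⁽ⁱ⁾(B)` (the three flattening ranks; `ζ⁽¹⁾` on the output leg) the three gauge packings read
`log t + (a+c)L ≤ X₁`, `log t + (a+b)L ≤ X₂`, `log t + (b+c)L ≤ X₃` (`L = log q`, §1), and `ζ⁽ⁱ⁾(B) ≤ R̃(B)` (§1, the second and
third through the rotation invariance of `R̃`).  If the certificate is EXACT (`U_B ≤ a+c`) then (§2): `R̃(B) = ζ⁽¹⁾(B) = t·q^{a+c}`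
(flat base, saturated output leg), `X₂, X₃ ≤ X₁`, the EXCESS inequalities `X₁ + b·L ≤ X₃ + a·L`, `X₁ + b·L ≤ X₂ + c·L`, the target
is inner-bound (read off the excess inequalities), and the VIRTUAL-FORMAT LAWS hold:

  `b·(X₁+X₂−X₃)·L ≤ a·(X₂+X₃−X₁)·L − (X₁−X₃)·log t`,   `b·(X₁+X₃−X₂)·L ≤ c·(X₂+X₃−X₁)·L − (X₁−X₂)·log t`

— i.e. with the VIRTUAL FORMAT `(A',B',C') := ½(X₁+X₂−X₃, X₂+X₃−X₁, X₁+X₃−X₂)` of `B` (for a format base `⟨s⟩ ⊗ ⟨p^{a'},p^{b'},p^{c'}⟩^{⊠N}`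
this is `N·log p·(a',b',c') + ½·log s·(1,1,1)`: a catalyst THICKENS the virtual format) these are gen 27's thinness and length laws
`b·A' ≤ a·B'`, `b·C' ≤ c·B'`, sharpened by the target multiplicity `t`.  §3: a REAL gauge transfer lemma and the conclusion — for
every slope `λ ≥ 0` and level `μ`, if the virtual format of `B` lies in the gauge class `G_{λ,μ}` (`B' < A'`, i.e. `ζ⁽³⁾(B) < ζ⁽¹⁾(B)`)
then so does every format it certifies exactly (`gauge_virtual_transfer`).  Hence the in-class account of the crux `SubexpSaturation`
(stmt-25909; two-sided constant `c₂`, gen 29) is BASE-INDEPENDENT: it prices single-base exact certificates from every tensor whose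
virtual format is a cone member.  The bases it does NOT price are the VIRTUALLY SQUARE flat tensors `ζ⁽³⁾(B) = ζ⁽¹⁾(B) = R̃(B)` (the
thinness law is then vacuous): among matrix multiplication formats these are exactly the far-edge formats `⟨p,p,p^k⟩` whose
tightness `E_k` is the ladder's own endpoint, and the unit tensors, whose certificates are the definition of border rank.
Support module beneath stmt-MatrixMultiplication-25909; closes no item; 0 sorry; no definitions; imports only BUILT modules.
[cite: ChristandlVranaZuiddam2023, §1.2 and Example 1.4; ChristandlLeGallLysikovZuiddam2020, Def. 3.10, Thm. 3.11 and Lemma 4.1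
(flattening ranks lower bound the asymptotic rank); AlmanDuanVassilevskaWilliamsXuXuZhou2025, Thm. 3.2; Blaser2013, §5.1;
LottiRomani1983, §1 (p. 173)]
-/

set_option linter.dupNamespace false

noncomputable section

open scoped BigOperators

namespace Summit.MatrixMultiplication.MatrixMultiplication.Theorems.SaturationLadderVirtualFormat

open Literature.Computability.AlgebraicComplexity
open Literature.Barriers.MatrixMultiplication
open Summit.MatrixMultiplication.MatrixMultiplication.Theorems.ConverseDoorLimit
  (spectral_le_of_polyDegeneratesTo map_unitTensor)  -- landed, imported

variable {K : Type} [Field K]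
variable {ι κ μ : Type} [Fintype ι] [Fintype κ] [Fintype μ]

/-! ## 1. The three packings of a single-base certificate and `ζ⁽ⁱ⁾ ≤ R̃` -/

section Packing

/-- **Single-base packing at a universal spectral point**: `B ⊵ ⟨t⟩ ⊗ ⟨A,B,C⟩` gives `t·F(⟨A,B,C⟩) ≤ F(B)`.
[cite: ChristandlVranaZuiddam2023, §1.2; Strassen1988, §2] -/
theorem base_spectral_packing_le {F : SpectralMap K} (hF : IsUniversalSpectralPoint K F)
    (Bs : ι → κ → μ → K) (t A B C : ℕ)
    (h : PolyDegeneratesTo Bs (kroneckerTensor (unitTensor K t) (matMulTensor K A B C))) :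
    (t : ℝ) * F (matMulTensor K A B C) ≤ F Bs := by
  have h1 := spectral_le_of_polyDegeneratesTo hF h
  rw [hF.map_kronecker, map_unitTensor hF] at h1
  exact h1

/-- `ζ⁽¹⁾`-packing `t·AC ≤ ζ⁽¹⁾(B)` (`B ≥ 1` as a dimension). [cite: ChristandlVranaZuiddam2023, Example 1.4] -/
theorem base_gauge₁_packing_le (Bs : ι → κ → μ → K) (t A B C : ℕ) (hB : 0 < B)
    (h : PolyDegeneratesTo Bs (kroneckerTensor (unitTensor K t) (matMulTensor K A B C))) :
    (t : ℝ) * ((A * C : ℕ) : ℝ) ≤ (flatteningRank Bs : ℝ) := by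
  have h1 := base_spectral_packing_le (gaugePoint₁_isUniversalSpectralPoint K) Bs t A B C h
  rwa [gaugePoint₁_matMulTensor hB, gaugePoint₁_eq] at h1

/-- `ζ⁽²⁾`-packing `t·AB ≤ ζ⁽²⁾(B)`. [cite: ChristandlVranaZuiddam2023, Example 1.4] -/
theorem base_gauge₂_packing_le (Bs : ι → κ → μ → K) (t A B C : ℕ) (hC : 0 < C)
    (h : PolyDegeneratesTo Bs (kroneckerTensor (unitTensor K t) (matMulTensor K A B C))) :
    (t : ℝ) * ((A * B : ℕ) : ℝ) ≤ gaugePoint₂ K Bs := by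
  have h1 := base_spectral_packing_le (gaugePoint₂_isUniversalSpectralPoint K) Bs t A B C h
  rwa [gaugePoint₂_matMulTensor hC] at h1

/-- `ζ⁽³⁾`-packing `t·CB ≤ ζ⁽³⁾(B)`. [cite: ChristandlVranaZuiddam2023, Example 1.4] -/
theorem base_gauge₃_packing_le (Bs : ι → κ → μ → K) (t A B C : ℕ) (hA : 0 < A)
    (h : PolyDegeneratesTo Bs (kroneckerTensor (unitTensor K t) (matMulTensor K A B C))) :
    (t : ℝ) * ((C * B : ℕ) : ℝ) ≤ gaugePoint₃ K Bs := by
  have h1 := base_spectral_packing_le (gaugePoint₃_isUniversalSpectralPoint K) Bs t A B C h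
  rwa [gaugePoint₃_matMulTensor hA] at h1

/-- **`ζ⁽²⁾(B) ≤ R̃(B)` and `ζ⁽³⁾(B) ≤ R̃(B)`**: the second and third flattenings are first flattenings of rotated copies of
`B` (slice transposition `flatteningRank_swap₂₃`, landed), and `R̃` is rotation invariant. [cite: ChristandlLeGallLysikovZuiddam2020, Lemma 4.1 (flattening ranks lower bound R̃); Blaser2013, §5.1] -/
theorem gaugePoint₂₃_le_asymptoticRank [DecidableEq ι] [DecidableEq κ] [DecidableEq μ] (Bs : ι → κ → μ → K) :
    gaugePoint₂ K Bs ≤ asymptoticRank Bs ∧ gaugePoint₃ K Bs ≤ asymptoticRank Bs := by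
  constructor
  · -- `ζ⁽²⁾(B) = ζ⁽¹⁾(swap₂₃ (rotate B))`
    have e : gaugePoint₂ K Bs = (flatteningRank (rotate Bs) : ℝ) := by
      rw [gaugePoint₂_eq_gaugePoint₁_swap, gaugePoint₁_eq, ← flatteningRank_swap₂₃ (rotate Bs)]
      rfl
    rw [e, ← asymptoticRank_rotate Bs]
    exact flatteningRank_le_asymptoticRank _
  · -- `ζ⁽³⁾(B) = ζ⁽¹⁾(rotate (rotate B))`
    have e : gaugePoint₃ K Bs = (flatteningRank (rotate (rotate Bs)) : ℝ) := by
      rw [gaugePoint₃_eq_gaugePoint₁_swap, gaugePoint₁_eq]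
      rfl
    rw [e, ← asymptoticRank_rotate Bs, ← asymptoticRank_rotate (rotate Bs)]
    exact flatteningRank_le_asymptoticRank _

end Packing

/-! ## 2. Exact single-base certificates: flatness, saturation, excess inequalities, virtual-format laws -/

section Exact

variable [DecidableEq ι] [DecidableEq κ] [DecidableEq μ]
variable {Bs : ι → κ → μ → K} {t q a b c : ℕ} (hq : 2 ≤ q) (ht : 1 ≤ t)
  (h : PolyDegeneratesTo Bs (kroneckerTensor (unitTensor K t) (matMulTensor K (q ^ a) (q ^ b) (q ^ c))))
  (hU : (Real.log (asymptoticRank Bs) - Real.log t) / Real.log q ≤ ((a + c : ℕ) : ℝ))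
include hq ht h hU

omit hU in
/-- **The certificate**: `ω(a,b,c) ≤ U_B = (log R̃(B) − log t)/log q` for every single base `B ⊵ ⟨t⟩ ⊗ ⟨q^a,q^b,q^c⟩`
(exactness not used). [cite: AlmanDuanVassilevskaWilliamsXuXuZhou2025, Thm. 3.2; ChristandlLeGallLysikovZuiddam2020, Def. 3.10] -/
theorem base_certificate_omegaRect_le :
    omegaRect K a b c ≤ (Real.log (asymptoticRank Bs) - Real.log t) / Real.log q := by
  have hle : (t : ℝ) * (q : ℝ) ^ omegaRect K a b c ≤ asymptoticRank Bs :=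
    (advxxz2025_thm32 K hq a b c ht).trans (asymptoticRank_le_of_polyDegeneratesTo h)
  have ht0 : (0 : ℝ) < t := by exact_mod_cast (by omega : 0 < t)
  have hq1 : (1 : ℝ) < q := by exact_mod_cast (by omega : 1 < q)
  have hq0 : (0 : ℝ) < q := by linarith
  have hL : 0 < Real.log q := Real.log_pos hq1
  have hlhs : 0 < (t : ℝ) * (q : ℝ) ^ omegaRect K a b c := mul_pos ht0 (Real.rpow_pos_of_pos hq0 _)
  have hR0 : 0 < asymptoticRank Bs := hlhs.trans_le hle
  have hlog := Real.log_le_log hlhs hle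
  rw [Real.log_mul ht0.ne' (Real.rpow_pos_of_pos hq0 _).ne', Real.log_rpow hq0] at hlog
  rw [le_div_iff₀ hL]
  linarith

/-- **The skeleton of an exact single-base certificate.**  With `L = log q`, `Xᵢ = log ζ⁽ⁱ⁾(B)`, `R = log R̃(B)`:
`R = X₁` (FLAT base), `log t + (a+c)L = X₁` (saturated output leg), `X₂ ≤ X₁`, `X₃ ≤ X₁`, and the two EXCESS inequalities
`X₁ + b·L ≤ X₃ + a·L`, `X₁ + b·L ≤ X₂ + c·L`. [cite: ChristandlVranaZuiddam2023, Example 1.4; ChristandlLeGallLysikovZuiddam2020, Thm. 3.11 and Lemma 4.1] -/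
theorem base_exact_skeleton :
    0 < Real.log q ∧
    Real.log (asymptoticRank Bs) = Real.log (flatteningRank Bs : ℝ) ∧
    Real.log t + ((a : ℝ) + c) * Real.log q = Real.log (flatteningRank Bs : ℝ) ∧
    Real.log (gaugePoint₂ K Bs) ≤ Real.log (flatteningRank Bs : ℝ) ∧
    Real.log (gaugePoint₃ K Bs) ≤ Real.log (flatteningRank Bs : ℝ) ∧
    Real.log (flatteningRank Bs : ℝ) + (b : ℝ) * Real.log q ≤ Real.log (gaugePoint₃ K Bs) + (a : ℝ) * Real.log q ∧
    Real.log (flatteningRank Bs : ℝ) + (b : ℝ) * Real.log q ≤ Real.log (gaugePoint₂ K Bs) + (c : ℝ) * Real.log q := by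
  have ht0 : (0 : ℝ) < t := by exact_mod_cast (by omega : 0 < t)
  have hq1 : (1 : ℝ) < q := by exact_mod_cast (by omega : 1 < q)
  have hq0 : (0 : ℝ) < q := by linarith
  have hL : 0 < Real.log q := Real.log_pos hq1
  -- the three packings, in logarithms
  have p1 := base_gauge₁_packing_le Bs t (q ^ a) (q ^ b) (q ^ c) (pow_pos (by omega) b) h
  have p2 := base_gauge₂_packing_le Bs t (q ^ a) (q ^ b) (q ^ c) (pow_pos (by omega) c) h
  have p3 := base_gauge₃_packing_le Bs t (q ^ a) (q ^ b) (q ^ c) (pow_pos (by omega) a) h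
  have e1 : (((q ^ a * q ^ c : ℕ)) : ℝ) = (q : ℝ) ^ (a + c) := by push_cast; ring
  have e2 : (((q ^ a * q ^ b : ℕ)) : ℝ) = (q : ℝ) ^ (a + b) := by push_cast; ring
  have e3 : (((q ^ c * q ^ b : ℕ)) : ℝ) = (q : ℝ) ^ (b + c) := by push_cast; ring
  rw [e1] at p1
  rw [e2] at p2
  rw [e3] at p3
  have hpos1 : (0 : ℝ) < (t : ℝ) * (q : ℝ) ^ (a + c) := mul_pos ht0 (pow_pos hq0 _)
  have hpos2 : (0 : ℝ) < (t : ℝ) * (q : ℝ) ^ (a + b) := mul_pos ht0 (pow_pos hq0 _)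
  have hpos3 : (0 : ℝ) < (t : ℝ) * (q : ℝ) ^ (b + c) := mul_pos ht0 (pow_pos hq0 _)
  have hζ1 : (0 : ℝ) < (flatteningRank Bs : ℝ) := hpos1.trans_le p1
  have hζ2 : (0 : ℝ) < gaugePoint₂ K Bs := hpos2.trans_le p2
  have hζ3 : (0 : ℝ) < gaugePoint₃ K Bs := hpos3.trans_le p3
  have l1 := Real.log_le_log hpos1 p1
  have l2 := Real.log_le_log hpos2 p2
  have l3 := Real.log_le_log hpos3 p3
  rw [Real.log_mul ht0.ne' (pow_pos hq0 _).ne', Real.log_pow] at l1 l2 l3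
  push_cast at l1 l2 l3
  -- `ζ⁽ⁱ⁾ ≤ R̃`, in logarithms
  have hR1 := flatteningRank_le_asymptoticRank Bs
  obtain ⟨hR2, hR3⟩ := gaugePoint₂₃_le_asymptoticRank (K := K) Bs
  have hR0 : 0 < asymptoticRank Bs := hζ1.trans_le hR1
  have m1 := Real.log_le_log hζ1 hR1
  have m2 := Real.log_le_log hζ2 hR2
  have m3 := Real.log_le_log hζ3 hR3
  -- exactness
  have hUL := (div_le_iff₀ hL).1 hU
  push_cast at hUL
  have hflat : Real.log (asymptoticRank Bs) = Real.log (flatteningRank Bs : ℝ) := by linarith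
  refine ⟨hL, hflat, by linarith, by linarith, by linarith, by linarith, by linarith⟩

/-- **Exactness forces a FLAT base with saturated output leg**: `R̃(B) = ζ⁽¹⁾(B) = t·q^{a+c}`. [cite: ChristandlVranaZuiddam2023, Example 1.4] -/
theorem base_exact_flat :
    asymptoticRank Bs = flatteningRank Bs ∧ (flatteningRank Bs : ℝ) = (t : ℝ) * (q : ℝ) ^ (a + c) := by
  obtain ⟨hL, hflat, hsat, -, -, -, -⟩ := base_exact_skeleton hq ht h hU
  have ht0 : (0 : ℝ) < t := by exact_mod_cast (by omega : 0 < t)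
  have hq0 : (0 : ℝ) < q := by exact_mod_cast (by omega : 0 < q)
  have p1 := base_gauge₁_packing_le Bs t (q ^ a) (q ^ b) (q ^ c) (pow_pos (by omega) b) h
  have e1 : (((q ^ a * q ^ c : ℕ)) : ℝ) = (q : ℝ) ^ (a + c) := by push_cast; ring
  rw [e1] at p1
  have hpos1 : (0 : ℝ) < (t : ℝ) * (q : ℝ) ^ (a + c) := mul_pos ht0 (pow_pos hq0 _)
  have hζ1 : (0 : ℝ) < (flatteningRank Bs : ℝ) := hpos1.trans_le p1
  have hR0 : 0 < asymptoticRank Bs := hζ1.trans_le (flatteningRank_le_asymptoticRank Bs)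
  refine ⟨Real.log_injOn_pos (Set.mem_Ioi.2 hR0) (Set.mem_Ioi.2 hζ1) hflat, ?_⟩
  have hlog : Real.log ((t : ℝ) * (q : ℝ) ^ (a + c)) = Real.log (flatteningRank Bs : ℝ) := by
    rw [Real.log_mul ht0.ne' (pow_pos hq0 _).ne', Real.log_pow]; push_cast; linarith
  exact (Real.log_injOn_pos (Set.mem_Ioi.2 hpos1) (Set.mem_Ioi.2 hζ1) hlog).symm

/-- **VIRTUAL THINNESS LAW**: `b·(X₁+X₂−X₃)·L ≤ a·(X₂+X₃−X₁)·L − (X₁−X₃)·log t` — with the virtual format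
`(A',B',C') = ½(X₁+X₂−X₃, X₂+X₃−X₁, X₁+X₃−X₂)` of the base this is `b·A' ≤ a·B'` sharpened by the multiplicity `t`
(for `B = ⟨p^{a'},p^{b'},p^{c'}⟩^{⊠N}`: `(A',B',C') = N log p·(a',b',c')`, gen 27 `exact_thinness_law`).
[cite: ChristandlLeGallLysikovZuiddam2020, Thm. 3.11 and Lemma 4.1] -/
theorem virtual_thinness_law :
    (b : ℝ) * (Real.log (flatteningRank Bs : ℝ) + Real.log (gaugePoint₂ K Bs) - Real.log (gaugePoint₃ K Bs)) *
        Real.log q ≤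
      (a : ℝ) * (Real.log (gaugePoint₂ K Bs) + Real.log (gaugePoint₃ K Bs) - Real.log (flatteningRank Bs : ℝ)) *
        Real.log q -
      (Real.log (flatteningRank Bs : ℝ) - Real.log (gaugePoint₃ K Bs)) * Real.log t := by
  obtain ⟨hL, -, hsat, m2, m3, x3, x2⟩ := base_exact_skeleton hq ht h hU
  have ht1 : (1 : ℝ) ≤ t := by exact_mod_cast ht
  have hlogt : 0 ≤ Real.log t := Real.log_nonneg ht1
  -- `X₂ ≥ log t + (a+b)L ≥ 0`
  have hX2 : 0 ≤ Real.log (gaugePoint₂ K Bs) := by nlinarith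
  have hd : 0 ≤ Real.log (flatteningRank Bs : ℝ) - Real.log (gaugePoint₃ K Bs) := by linarith
  -- `(X₁−X₃)·(log t + (a+b)L) ≤ (X₁−X₃)·X₂` and `X₂·(X₁−X₃) ≤ X₂·(a−b)L`
  have p2 : Real.log t + ((a : ℝ) + b) * Real.log q ≤ Real.log (gaugePoint₂ K Bs) := by linarith
  have e3 : Real.log (flatteningRank Bs : ℝ) - Real.log (gaugePoint₃ K Bs) ≤ ((a : ℝ) - b) * Real.log q := by
    linarith
  have k1 := mul_le_mul_of_nonneg_left p2 hd
  have k2 := mul_le_mul_of_nonneg_left e3 hX2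
  nlinarith

/-- **VIRTUAL LENGTH LAW**: `b·(X₁+X₃−X₂)·L ≤ c·(X₂+X₃−X₁)·L − (X₁−X₂)·log t`, i.e. `b·C' ≤ c·B'` sharpened by `t`.
[cite: ChristandlLeGallLysikovZuiddam2020, Thm. 3.11 and Lemma 4.1] -/
theorem virtual_length_law :
    (b : ℝ) * (Real.log (flatteningRank Bs : ℝ) + Real.log (gaugePoint₃ K Bs) - Real.log (gaugePoint₂ K Bs)) *
        Real.log q ≤
      (c : ℝ) * (Real.log (gaugePoint₂ K Bs) + Real.log (gaugePoint₃ K Bs) - Real.log (flatteningRank Bs : ℝ)) *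
        Real.log q -
      (Real.log (flatteningRank Bs : ℝ) - Real.log (gaugePoint₂ K Bs)) * Real.log t := by
  obtain ⟨hL, -, hsat, m2, m3, x3, x2⟩ := base_exact_skeleton hq ht h hU
  have ht1 : (1 : ℝ) ≤ t := by exact_mod_cast ht
  have hlogt : 0 ≤ Real.log t := Real.log_nonneg ht1
  have hX3 : 0 ≤ Real.log (gaugePoint₃ K Bs) := by nlinarith
  have hd : 0 ≤ Real.log (flatteningRank Bs : ℝ) - Real.log (gaugePoint₂ K Bs) := by linarith
  have p3 : Real.log t + ((b : ℝ) + c) * Real.log q ≤ Real.log (gaugePoint₃ K Bs) := by linarith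
  have e2 : Real.log (flatteningRank Bs : ℝ) - Real.log (gaugePoint₂ K Bs) ≤ ((c : ℝ) - b) * Real.log q := by
    linarith
  have k1 := mul_le_mul_of_nonneg_left p3 hd
  have k2 := mul_le_mul_of_nonneg_left e2 hX3
  nlinarith

/-- **The laws in ratio form** (`t ≥ 1` only helps): with `A' = X₁+X₂−X₃`, `B' = X₂+X₃−X₁`, `C' = X₁+X₃−X₂` (twice the
virtual format), `b·A' ≤ a·B'` and `b·C' ≤ c·B'`. [cite: ChristandlLeGallLysikovZuiddam2020, Thm. 3.11 and Lemma 4.1] -/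
theorem virtual_laws :
    (b : ℝ) * (Real.log (flatteningRank Bs : ℝ) + Real.log (gaugePoint₂ K Bs) - Real.log (gaugePoint₃ K Bs)) ≤
      (a : ℝ) * (Real.log (gaugePoint₂ K Bs) + Real.log (gaugePoint₃ K Bs) - Real.log (flatteningRank Bs : ℝ)) ∧
    (b : ℝ) * (Real.log (flatteningRank Bs : ℝ) + Real.log (gaugePoint₃ K Bs) - Real.log (gaugePoint₂ K Bs)) ≤
      (c : ℝ) * (Real.log (gaugePoint₂ K Bs) + Real.log (gaugePoint₃ K Bs) - Real.log (flatteningRank Bs : ℝ)) := by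
  obtain ⟨hL, -, -, m2, m3, -, -⟩ := base_exact_skeleton hq ht h hU
  have hthin := virtual_thinness_law hq ht h hU
  have hlen := virtual_length_law hq ht h hU
  have ht1 : (1 : ℝ) ≤ t := by exact_mod_cast ht
  have hlogt : 0 ≤ Real.log t := Real.log_nonneg ht1
  have s1 : 0 ≤ (Real.log (flatteningRank Bs : ℝ) - Real.log (gaugePoint₃ K Bs)) * Real.log t :=
    mul_nonneg (by linarith) hlogt
  have s2 : 0 ≤ (Real.log (flatteningRank Bs : ℝ) - Real.log (gaugePoint₂ K Bs)) * Real.log t :=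
    mul_nonneg (by linarith) hlogt
  constructor
  · have k : (b : ℝ) * (Real.log (flatteningRank Bs : ℝ) + Real.log (gaugePoint₂ K Bs) -
        Real.log (gaugePoint₃ K Bs)) * Real.log q ≤
        (a : ℝ) * (Real.log (gaugePoint₂ K Bs) + Real.log (gaugePoint₃ K Bs) - Real.log (flatteningRank Bs : ℝ)) *
        Real.log q := by linarith
    exact le_of_mul_le_mul_right k hL
  · have k : (b : ℝ) * (Real.log (flatteningRank Bs : ℝ) + Real.log (gaugePoint₃ K Bs) -
        Real.log (gaugePoint₂ K Bs)) * Real.log q ≤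
        (c : ℝ) * (Real.log (gaugePoint₂ K Bs) + Real.log (gaugePoint₃ K Bs) - Real.log (flatteningRank Bs : ℝ)) *
        Real.log q := by linarith
    exact le_of_mul_le_mul_right k hL

end Exact

/-! ## 3. The gauge cone prices every base through its virtual format -/

section Cone

/-- **Real gauge transfer**: the arithmetic of gen 29 `gauge_transfer` for a REAL base point `(A',B',C')` with `0 < B' < A'`,
`0 ≤ C'`: the laws `b·A' ≤ a·B'`, `b·C' ≤ c·B'` (`b ≥ 1`) carry `G_{λ,μ}` (`λ ≥ 0`) from `(A',B',C')` to `(a,b,c)`.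
[cite: CoppersmithWinograd1990, §8 (pp. 268–269); ChristandlLeGallLysikovZuiddam2020, Thm. 3.11] -/
theorem gaugeReal_transfer {lam lev A' B' C' : ℝ} {a b c : ℕ} (hlam : 0 ≤ lam) (hb : 1 ≤ b) (hB' : 0 < B')
    (hAB' : B' < A') (hC' : 0 ≤ C') (hthin : (b : ℝ) * A' ≤ (a : ℝ) * B') (hlen : (b : ℝ) * C' ≤ (c : ℝ) * B')
    (hfloor : lam * (B' / (A' - B')) ≤ Real.log ((A' + C') / B') + lev) :
    b < a ∧ lam * ((b : ℝ) / ((a : ℝ) - b)) ≤ Real.log (((a : ℝ) + c) / b) + lev := by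
  have hbR : (1 : ℝ) ≤ b := by exact_mod_cast hb
  have hba : b < a := by
    by_contra hle
    have hleR : (a : ℝ) ≤ b := by exact_mod_cast (not_lt.1 hle)
    nlinarith
  have hbaR : (b : ℝ) + 1 ≤ a := by exact_mod_cast hba
  refine ⟨hba, ?_⟩
  have hd : (0 : ℝ) < (a : ℝ) - b := by linarith
  have hd' : (0 : ℝ) < A' - B' := by linarith
  have hκ : (b : ℝ) / ((a : ℝ) - b) ≤ B' / (A' - B') := by
    rw [div_le_div_iff₀ hd hd']; nlinarith
  have hb0 : (0 : ℝ) < b := by linarith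
  have hc0 : (0 : ℝ) ≤ c := Nat.cast_nonneg c
  have hg : (A' + C') / B' ≤ ((a : ℝ) + c) / b := by
    rw [div_le_div_iff₀ hB' hb0]; nlinarith
  have hg0 : 0 < (A' + C') / B' := div_pos (by linarith) hB'
  have hlogg := Real.log_le_log hg0 hg
  nlinarith [mul_le_mul_of_nonneg_left hκ hlam]

variable [DecidableEq ι] [DecidableEq κ] [DecidableEq μ]

/-- **`G_{λ,μ}` PRICES EVERY BASE**: if an arbitrary tensor `B` with `ζ⁽³⁾(B) < ζ⁽¹⁾(B)` has its virtual format
`(X₁+X₂−X₃, X₂+X₃−X₁, X₁+X₃−X₂)` (`Xᵢ = log ζ⁽ⁱ⁾(B)`) in the gauge class `G_{λ,μ}` (`λ ≥ 0`), then every format `⟨q^a,q^b,q^c⟩`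
(`b ≥ 1`) it certifies EXACTLY — `B ⊵ ⟨t⟩ ⊗ ⟨q^a,q^b,q^c⟩`, `(log R̃(B) − log t)/log q ≤ a + c` — lies in `G_{λ,μ}`: the
two-sided saturation constant of gen 29 bounds single-base exact certificates from ALL cone-member tensors, not only from
matrix multiplication formats. [cite: ChristandlVranaZuiddam2023, Example 1.4; ChristandlLeGallLysikovZuiddam2020, Thm. 3.11 and
Lemma 4.1; CoppersmithWinograd1990, §8] -/
theorem gauge_virtual_transfer {lam lev : ℝ} {Bs : ι → κ → μ → K} {t q a b c : ℕ} (hq : 2 ≤ q) (ht : 1 ≤ t)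
    (h : PolyDegeneratesTo Bs (kroneckerTensor (unitTensor K t) (matMulTensor K (q ^ a) (q ^ b) (q ^ c))))
    (hU : (Real.log (asymptoticRank Bs) - Real.log t) / Real.log q ≤ ((a + c : ℕ) : ℝ))
    (hlam : 0 ≤ lam) (hb : 1 ≤ b) (h31 : gaugePoint₃ K Bs < (flatteningRank Bs : ℝ))
    (hfloor : lam * ((Real.log (gaugePoint₂ K Bs) + Real.log (gaugePoint₃ K Bs) - Real.log (flatteningRank Bs : ℝ)) /
        ((Real.log (flatteningRank Bs : ℝ) + Real.log (gaugePoint₂ K Bs) - Real.log (gaugePoint₃ K Bs)) -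
          (Real.log (gaugePoint₂ K Bs) + Real.log (gaugePoint₃ K Bs) - Real.log (flatteningRank Bs : ℝ)))) ≤
      Real.log (((Real.log (flatteningRank Bs : ℝ) + Real.log (gaugePoint₂ K Bs) - Real.log (gaugePoint₃ K Bs)) +
          (Real.log (flatteningRank Bs : ℝ) + Real.log (gaugePoint₃ K Bs) - Real.log (gaugePoint₂ K Bs))) /
        (Real.log (gaugePoint₂ K Bs) + Real.log (gaugePoint₃ K Bs) - Real.log (flatteningRank Bs : ℝ))) + lev) :
    b < a ∧ lam * ((b : ℝ) / ((a : ℝ) - b)) ≤ Real.log (((a : ℝ) + c) / b) + lev := by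
  obtain ⟨hL, -, hsat, m2, m3, x3, x2⟩ := base_exact_skeleton hq ht h hU
  obtain ⟨hthin, hlen⟩ := virtual_laws hq ht h hU
  have ht0 : (0 : ℝ) < t := by exact_mod_cast (by omega : 0 < t)
  have hq0 : (0 : ℝ) < q := by exact_mod_cast (by omega : 0 < q)
  have ht1 : (1 : ℝ) ≤ t := by exact_mod_cast ht
  have hlogt : 0 ≤ Real.log t := Real.log_nonneg ht1
  have hbR : (1 : ℝ) ≤ b := by exact_mod_cast hb
  -- positivity of `ζ⁽³⁾(B)`: from the packing `t·q^{b+c} ≤ ζ⁽³⁾(B)`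
  have p3 := base_gauge₃_packing_le Bs t (q ^ a) (q ^ b) (q ^ c) (pow_pos (by omega) a) h
  have e3 : (((q ^ c * q ^ b : ℕ)) : ℝ) = (q : ℝ) ^ (b + c) := by push_cast; ring
  rw [e3] at p3
  have hζ3 : (0 : ℝ) < gaugePoint₃ K Bs := (mul_pos ht0 (pow_pos hq0 _)).trans_le p3
  have hX31 : Real.log (gaugePoint₃ K Bs) < Real.log (flatteningRank Bs : ℝ) := Real.log_lt_log hζ3 h31
  -- `B' = X₂+X₃−X₁ ≥ 2(log t + b L) > 0`
  have hB' : 0 < Real.log (gaugePoint₂ K Bs) + Real.log (gaugePoint₃ K Bs) - Real.log (flatteningRank Bs : ℝ) := by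
    nlinarith
  have hAB' : Real.log (gaugePoint₂ K Bs) + Real.log (gaugePoint₃ K Bs) - Real.log (flatteningRank Bs : ℝ) <
      Real.log (flatteningRank Bs : ℝ) + Real.log (gaugePoint₂ K Bs) - Real.log (gaugePoint₃ K Bs) := by linarith
  have hC' : 0 ≤ Real.log (flatteningRank Bs : ℝ) + Real.log (gaugePoint₃ K Bs) - Real.log (gaugePoint₂ K Bs) := by
    linarith
  exact gaugeReal_transfer hlam hb hB' hAB' hC' hthin hlen hfloor

end Cone

end Summit.MatrixMultiplication.MatrixMultiplication.Theorems.SaturationLadderVirtualFormat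

end
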